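import Literature.Algebra.Homology.ConjugateSubgroupCohomology
import Literature.Algebra.Homology.DoubleCosetFormula
import Literature.Algebra.Homology.CorestrictionTransitive
import HarnessLib

/-!
# The two spellings of Brown's `res^{gHg⁻¹}_{K ∩ gHg⁻¹} (gz)` and of the `G`-invariant (stable) classes agree
# (Brown, *Cohomology of Groups* III §8–§10) — a bridge between `ConjugateSubgroupCohomology`,
# `DoubleCosetFormula` and `CorestrictionTransitive`

Topic `Algebra/Homology`; namespace `Literature.Algebra.Homology`; theorems only; NO named fact, no
`sorry`.  Lane `lit-hodgefound` (Track 2 foundations library), seat p30 gen 22, row g22-#4 of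
`run/shared/lean/pub/lit-hodgefound/SKELETON.md`.  Imports the tree's `ConjugateSubgroupCohomology`
(g22-#1: `conjMap H K A g n : Hⁿ(H, A|_H) → Hⁿ(K, A|_K)` for SUBGROUPS `K ⊆ gHg⁻¹` OF `G`, `IsConjInvariant`,
`conjInvariants`, `conjMap_comp`, `conjMap_one_injective`), `DoubleCosetFormula` (g22-#2:
`cosetStabilizer H K g = K_g ≤ K` a subgroup OF `K`, `conjResMap H K A g n : Hⁿ(H, A|_H) → Hⁿ(K_g, (A|_K)|_{K_g})`,
`IsStableClass`, `stableClasses`, `map_subtype_cosetStabilizer : K_g = K ∩ gHg⁻¹`) and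
`CorestrictionTransitive` (g22-#3: `toAmbient K K_g = K_g.map K.subtype ≤ G`, the identification
`mapToAmbient : Hⁿ(K_g, (A|_K)|_{K_g}) ⟶ Hⁿ(K_g ≤ G, A|_{K_g})`, an isomorphism `isoToAmbient`).

Brown (III §10, p. 84 of the held copy `book:brown1982-cohomology-groups`, chunk p0092) calls
`z ∈ H^*(H, M)` `G`-invariant if "`res^H_{H ∩ gHg⁻¹} z = res^{gHg⁻¹}_{H ∩ gHg⁻¹} gz` for all `g ∈ G`".  The
tree spells this twice: `IsConjInvariant` (g22-#1; both sides in `Hⁿ(H ∩ gHg⁻¹, A)` with `H ∩ gHg⁻¹` a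
subgroup of `G`) and `IsStableClass` (g22-#2; both sides in `Hⁿ(H_g, A)` with `H_g = Stab_H(gH)` a
subgroup of `H`, the form in which the double coset formula and Thm. 10.3 are proved).  This file proves
the two spellings equal, so that Thm. 10.3 / Prop. 10.4 of `DoubleCosetFormula` may be read with either.

## What is formalised

* §1 **`conjResMap_comp_mapToAmbient`** (`conjResMap H K A g ≫ mapToAmbient = conjMap H (K_g ≤ G) A g`),
  **`res_comp_mapToAmbient`** (`res^K_{K_g} ≫ mapToAmbient = conjMap K (K_g ≤ G) A 1`).
* §2 `toAmbient_cosetStabilizer_eq_inf` (`H_g ≤ G` is `H ∩ gHg⁻¹`), `conjResMap_eq_res_iff` (the two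
  equations at one `g` are equivalent), **`isStableClass_iff_isConjInvariant`**,
  **`stableClasses_eq_conjInvariants`**.

## References
* K. S. Brown, *Cohomology of Groups*, GTM 87, Springer (1982), III §8 (p. 79), Prop. 9.5 (iii)
  (p. 83), §10 (p. 84). [Brown1982CohomologyGroups]
-/

noncomputable section

open CategoryTheory groupCohomology
open scoped Pointwise

universe u

namespace Literature.Algebra.Homology

variable {k G : Type u} [CommRing k] [Group G] (H K : Subgroup G) (A : Rep.{u} k G) (g : G)

/-! ## §1 `conjResMap` (target `K_g ≤ K`) versus `conjMap` (target `K_g ≤ G`) -/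

omit A in
/-- `g⁻¹ (K_g) g ⊆ H` for `K_g = K ∩ gHg⁻¹` viewed in `G`. [cite: Brown1982CohomologyGroups, III §9
(p. 83)] -/
theorem inv_mul_mul_mem_of_mem_toAmbient_cosetStabilizer :
    ∀ x ∈ toAmbient K (cosetStabilizer H K g), g⁻¹ * x * g ∈ H := by
  rintro _ ⟨t, ht, rfl⟩
  exact (mem_cosetStabilizer_iff H K g t).1 ht

omit A in
/-- `1⁻¹ (K_g) 1 ⊆ K`. [cite: Brown1982CohomologyGroups, III §9 (p. 83)] -/
theorem one_inv_mul_mul_one_mem_of_mem_toAmbient_cosetStabilizer :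
    ∀ x ∈ toAmbient K (cosetStabilizer H K g), (1 : G)⁻¹ * x * 1 ∈ K :=
  one_inv_mul_mul_one_mem_of_le K _ (toAmbient_le K (cosetStabilizer H K g))

/-- **`res^{gHg⁻¹}_{K_g}(g·)` in the two spellings agree**: `DoubleCosetFormula.conjResMap H K A g`
(target the subgroup `K_g` of `K`) followed by the identification `mapToAmbient` of
`CorestrictionTransitive` is `ConjugateSubgroupCohomology.conjMap H (K_g ≤ G) A g`.
[cite: Brown1982CohomologyGroups, III §8 (p. 79), Prop. 9.5 (iii) (p. 83)] -/
theorem conjResMap_comp_mapToAmbient (n : ℕ) :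
    conjResMap H K A g n ≫ mapToAmbient K (cosetStabilizer H K g) A n =
      conjMap H (toAmbient K (cosetStabilizer H K g)) A g
        (inv_mul_mul_mem_of_mem_toAmbient_cosetStabilizer H K g) n := by
  rw [conjResMap, mapToAmbient, conjMap, ← groupCohomology.map_comp]
  refine map_congr' ?_ _ _ (fun a => ?_) n
  · refine MonoidHom.ext fun y => Subtype.ext ?_
    change g⁻¹ * ((((toAmbientEquiv K (cosetStabilizer H K g)).symm y : cosetStabilizer H K g) : K) : G)
      * g = g⁻¹ * (y : G) * g
    rw [coe_coe_toAmbientEquiv_symm_apply]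
  · rfl

/-- **`res^K_{K_g}` in the two spellings agree**: Mathlib's restriction `Hⁿ(K_g ↪ K, 𝟙)` followed by
`mapToAmbient` is `conjMap K (K_g ≤ G) A 1`. [cite: Brown1982CohomologyGroups, III §9 (p. 83)] -/
theorem res_comp_mapToAmbient (n : ℕ) :
    groupCohomology.map (cosetStabilizer H K g).subtype
        (𝟙 (Rep.res (cosetStabilizer H K g).subtype (resSub K A))) n ≫
        mapToAmbient K (cosetStabilizer H K g) A n =
      conjMap K (toAmbient K (cosetStabilizer H K g)) A 1
        (one_inv_mul_mul_one_mem_of_mem_toAmbient_cosetStabilizer H K g) n := by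
  rw [mapToAmbient, conjMap, ← groupCohomology.map_comp]
  refine map_congr' ?_ _ _ (fun a => ?_) n
  · refine MonoidHom.ext fun y => Subtype.ext ?_
    change ((((toAmbientEquiv K (cosetStabilizer H K g)).symm y : cosetStabilizer H K g) : K) : G) =
      1⁻¹ * (y : G) * 1
    rw [coe_coe_toAmbientEquiv_symm_apply, inv_one, one_mul, mul_one]
  · change a = A.ρ 1 a
    rw [map_one]
    rfl

/-! ## §2 Stable classes: `IsStableClass` (`DoubleCosetFormula`) ⟺ `IsConjInvariant`
(`ConjugateSubgroupCohomology`) -/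

omit K A in
/-- `H_g` viewed in `G` is `H ∩ gHg⁻¹`. [cite: Brown1982CohomologyGroups, III §10 (p. 84)] -/
theorem toAmbient_cosetStabilizer_eq_inf :
    toAmbient H (cosetStabilizer H H g) = H ⊓ MulAut.conj g • H :=
  map_subtype_cosetStabilizer H H g

omit K in
/-- For one `g`: the `IsStableClass` equation at `g` holds iff the `IsConjInvariant` equation at `g`
holds. [cite: Brown1982CohomologyGroups, III §10 (p. 84)] -/
theorem conjResMap_eq_res_iff (n : ℕ) (z : groupCohomology (resSub H A) n) :
    (conjResMap H H A g n).hom z =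
        (groupCohomology.map (cosetStabilizer H H g).subtype
          (𝟙 (Rep.res (cosetStabilizer H H g).subtype (resSub H A))) n).hom z ↔
      (conjMap H (H ⊓ MulAut.conj g • H) A 1 (one_inv_mul_mul_one_mem_of_mem_inf H g) n).hom z =
        (conjMap H (H ⊓ MulAut.conj g • H) A g (inv_mul_mul_mem_of_mem_inf H g) n).hom z := by
  -- Step 1: transport the left equation along the isomorphism `mapToAmbient`
  have hinj : Function.Injective (mapToAmbient H (cosetStabilizer H H g) A n).hom :=
    (Iso.toLinearEquiv (isoToAmbient H (cosetStabilizer H H g) A n)).injective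
  have hL : (conjResMap H H A g n).hom z =
        (groupCohomology.map (cosetStabilizer H H g).subtype
          (𝟙 (Rep.res (cosetStabilizer H H g).subtype (resSub H A))) n).hom z ↔
      (conjMap H (toAmbient H (cosetStabilizer H H g)) A g
          (inv_mul_mul_mem_of_mem_toAmbient_cosetStabilizer H H g) n).hom z =
        (conjMap H (toAmbient H (cosetStabilizer H H g)) A 1
          (one_inv_mul_mul_one_mem_of_mem_toAmbient_cosetStabilizer H H g) n).hom z := by
    rw [← hinj.eq_iff, ← LinearMap.comp_apply, ← ModuleCat.hom_comp, conjResMap_comp_mapToAmbient,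
      ← LinearMap.comp_apply (f := (mapToAmbient H (cosetStabilizer H H g) A n).hom),
      ← ModuleCat.hom_comp, res_comp_mapToAmbient]
  rw [hL]
  -- Step 2: move the target from `toAmbient H H_g` to the equal subgroup `H ⊓ gHg⁻¹`
  set L := toAmbient H (cosetStabilizer H H g) with hLdef
  have hle : H ⊓ MulAut.conj g • H ≤ L := (toAmbient_cosetStabilizer_eq_inf H g).symm.le
  have hge : L ≤ H ⊓ MulAut.conj g • H := (toAmbient_cosetStabilizer_eq_inf H g).le
  have hinj' := conjMap_one_injective L (H ⊓ MulAut.conj g • H) A hle hge n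
  have hcomp : ∀ (x : G) (hx : ∀ y ∈ L, x⁻¹ * y * x ∈ H) (hx' : ∀ y ∈ H ⊓ MulAut.conj g • H, x⁻¹ * y * x ∈ H),
      conjMap H L A x hx n ≫ conjMap L (H ⊓ MulAut.conj g • H) A 1
          (one_inv_mul_mul_one_mem_of_le L _ hle) n =
        conjMap H (H ⊓ MulAut.conj g • H) A x hx' n := fun x hx hx' => by
    rw [conjMap_comp H L A x hx _ 1 _ (fun y hy => by simpa only [one_mul] using hx' y hy)]
    exact conjMap_congr H _ A (one_mul x) _ _ n
  rw [← hinj'.eq_iff, ← LinearMap.comp_apply, ← ModuleCat.hom_comp, hcomp,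
    ← LinearMap.comp_apply (f := (conjMap L (H ⊓ MulAut.conj g • H) A 1 _ n).hom),
    ← ModuleCat.hom_comp, hcomp, eq_comm]

omit K g in
/-- **The `G`-invariant (stable) classes of `DoubleCosetFormula` and of `ConjugateSubgroupCohomology`
are the same**: `IsStableClass H A n z ↔ IsConjInvariant H A n z`. [cite: Brown1982CohomologyGroups,
III §10 (p. 84)] -/
theorem isStableClass_iff_isConjInvariant (n : ℕ) (z : groupCohomology (resSub H A) n) :
    IsStableClass H A n z ↔ IsConjInvariant H A n z :=
  forall_congr' fun g => conjResMap_eq_res_iff H A g n z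

omit K g in
/-- The two submodules of stable classes coincide. [cite: Brown1982CohomologyGroups, III §10 (p. 84)] -/
theorem stableClasses_eq_conjInvariants (n : ℕ) : stableClasses H A n = conjInvariants H A n :=
  Submodule.ext fun z => isStableClass_iff_isConjInvariant H A n z

end Literature.Algebra.Homology
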